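/- Copyright: the b2b-balaban cell (near-miss cell 7), T⁴-continuum fan-out; row NE7b CRUX team (2), seat
t4-ne7b-formalise-leaf-02 (gen 25; the row owner's INTERFACE REQUEST NE7b IR-42-2 of ruling R-OWNER-42-2 «M5's cost side
is stated in TOTAL (lifeCost) form», `CLAIMS.log` l.29149, E-side part (E8T) — THE W-HEADLINE WITH THE COST SIDE READ IN
TOTAL FORM: the headline of record p224237 ∕ the W-headline p255842 re-plugged over the total-form witness).  Released
under the licence of the surrounding project. -/
import Summits.QuantumFields.BalabanUV.T4Continuum.Support.HistoryRealiseCellsRunPinnedT3bPWT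
import Summits.QuantumFields.BalabanUV.T4Continuum.Support.HistoryRealiseCellsRunApexT3bWT
import Summits.QuantumFields.BalabanUV.T4Continuum.Support.HistoryRealiseCellsRunHeadlineT3bPW

/-!
# Realised histories: THE HEADLINE FROM THE COUNT ROAD OVER THE REPAIRED END v3.1, MEMORY-AGNOSTIC CARRIER, COST SIDE IN
TOTAL FORM (the total-form W-HEADLINE; INTERFACE REQUEST NE7b IR-42-2, E-side, file E8T = the terminal E-side statement)

Summits-side support leaf of the T⁴-continuum cell (rung (B)+1 on a FINITE torus only; NOT infinite volume, NOT the
mass gap, NOT the Clay statement; NOT a proof of the spine estimate NE7b, which is the cell's OWN estimate, NOT PRINTED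
and NOT PROVED).  Row NE7b, route «COUNT» ∕ R-P1, re-open object (α); row S12-W of
`t4/b2b-balaban-t4-ne7b-p1/LEAVES-NE7b.md`; the owner's IR-42-2 (`CLAIMS.log` l.29149, `HOME/INBOX.md` l.4594–4598: «in
the W-END of record and its headline twin, READ `cost_le`∕`cost_le'` IN TOTAL FORM») as split by the S12-W custodian
leaf-03 (`CLAIMS.log` l.29200: W-files → leaf-03, E-files → leaf-02): E8T = the total-form twin of this seat's E8
`HistoryRealiseCellsRunHeadlineT3bPW` (p255842, the W-HEADLINE), itself the W-twin of the headline of record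
`HistoryRealiseCellsRunHeadlineT3bP` (p224237).

WHY ∕ WHAT.  Ruling R-OWNER-42-2 (READING OF RECORD, kernel, by name): the END consumes the witness's H3 cost fields
`cost_le`∕`cost_le'` ONLY through `lifeCostT_mono = Finset.sum_le_sum`, so their TOTAL (lifeCost) form is a drop-in
WEAKER reading with the same consequence; the owner's located design observation O-M5-1 (merger cascades realise several
unit boxes at a step where `costT` books one floor) is why the (α) brick M5-1 `HistoryGenealogyBankingCost` will supply
the total form.  The six theorems of the W-headline RE-PLUGGED over the total-form witness `CountRoadWitnessT3bWT` (file
E6T: E6's `CountRoadWitnessT3bW` with `cost_le`∕`cost_le'` in total form, every other field — the memory-agnostic carrier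
`realised : RealisedDomainsRW …` included — token-identical) and the total-form W-pinned repaired END
`HistoryRealiseCellsRunPinnedT3bPWT.hybridNE7_of_realisedDomainsRunW_pinnedT3bPDT` (file E5T, over leaf-03's W9T):
**`hybridNE7Under_of_countRoadT3bPWT_fsc`**, `hybridNE7Under_of_countRoadT3bPWT`, `limit_exists_of_countRoadT3bPWT_fsc`,
`limit_unique_of_countRoadT3bPWT_fsc`, `targets_of_countRoadT3bPWT_fsc`, **`continuumYM4Torus_of_countRoadT3bPWT_fsc`**
— statements = E8's (= p224237's) with `CountRoadWitnessT3bW ↦ CountRoadWitnessT3bWT` (the ONLY change in the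
hypothesis), proofs = E8's with `…RunW_pinnedT3bPD ↦ …RunW_pinnedT3bPDT`, `stringHybridNE7_of_hybridNE7T3bW ↦ …T3bWT`;
conclusions (`HybridNE7Under D (BetaPertHyp D.βfun)`, `D.ym4_torus_continuum_limit_exists ∕ _unique`, the four targets,
`T4ContinuumYM4Torus.ContinuumYM4Torus D`) BYTE-IDENTICAL.  The carrier- and cost-free `exists_consts_countRoadT3bP` (the
constants-side antecedent is inhabited) is NOT restated — BY NAME from p224237, imported.  Since `CountRoadWitnessT3bW.toT`
(E6T) maps every W-witness to a total-form one and `CountRoadWitnessT3b.toWT` every landed-carrier witness, this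
total-form W-headline IMPLIES the W-headline E8 AND the headline of record p224237 — KERNEL-CHECKED here as the two
closing `example`s (E8's ∕ p224237's own hypothesis ⇒ their conclusion through the total-form chain,
`ForSmallCouplings.mono`; `example`s and not named theorems because their statements ARE, binder for binder, E8's
`continuumYM4Torus_of_countRoadT3bPW_fsc` ∕ p224237's `continuumYM4Torus_of_countRoadT3bP_fsc` — named copies would
restate landed declarations).  [folklore] composition by name; no `def`, no `[cite:]` tag, nothing printed asserted, no
`Prop` fact minted (c1), zero `sorry`.  Append-only: p224237 and p255842 stay, UNCHANGED BY NAME.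

HONEST READING (unchanged but for the cost side): `ContinuumYM4Torus D` for (0.4)-block-averaged `SU(N)` data ⇐
(B) = `B16.EndStatementBPrinted D.C` ∧ `BetaPertHyp D.βfun` (BY NAME) ∧ the datum's sign conventions ∧ the repaired END's
INHABITED constants-only side conditions ∧ [∀ small-coupling tuned run ∀ loop string, a `CountRoadWitnessT3bWT`]; the
witness DISPLAYS H3^NE7b in its W-form with the cost side in TOTAL form (a by-name WEAKENING of one displayed binder of
OUR bookkeeping — same class R until the owner's M5-1 discharges it), the E1∕E2 representation identities, the (B)-side
data, NE7c's `ShellWeightBound`, NE7's `ReindexedBudget`, four summable rates — hypothesis shapes, none in print, none a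
theorem of the tree; NOTHING of them is discharged here; by-name class of every `WALL-NE7b-P1.md` §2 binder UNCHANGED;
located open point G-M4-1 (touch-connected births) untouched; NE7b NOT proved; spine count 0∕9.  HONEST DEPENDENCY
(cell): continuum YM on T⁴ ⇐ BetaPertH ∧ nine spine estimates (0/9 proved); BetaPertH ⇐ (D1) ∧ (D4) ∧ CAP+tail; G-an2-4
gates asym, D1 and NE2/3/4.  This file changes none of it. -/

open Literature.MathematicalPhysics.QuantumFieldTheory.Balaban1983to89
open T4Continuum T4PrintedShapeBanking T4CanonicalMenus
open Summit.QuantumFields.BalabanUV.T4Continuum.CountThresholdUniform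
open Summit.QuantumFields.BalabanUV.T4Continuum.HistoryConstants
open Summit.QuantumFields.BalabanUV.T4Continuum.HistoryZoneEvolve (cth)
open Summit.QuantumFields.BalabanUV.T4Continuum.HistoryRealiseCellsRunPinnedT3bP
open Summit.QuantumFields.BalabanUV.T4Continuum.HistoryRealiseCellsRunApexT3b

open Summit.QuantumFields.BalabanUV.T4Continuum.HistoryRealisePrint Summit.QuantumFields.BalabanUV.T4Continuum.HistoryRealiseWeak
open Summit.QuantumFields.BalabanUV.T4Continuum.HistoryRealisePrintReading Summit.QuantumFields.BalabanUV.T4Continuum.HistoryRealiseWeakReading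
open Summit.QuantumFields.BalabanUV.T4Continuum.HistoryRealisePrintCells Summit.QuantumFields.BalabanUV.T4Continuum.HistoryRealiseWeakCells
open Summit.QuantumFields.BalabanUV.T4Continuum.HistoryRealiseCellsRunMultEndPDW Summit.QuantumFields.BalabanUV.T4Continuum.HistoryRealiseCellsRunPinnedT3bPW
open Summit.QuantumFields.BalabanUV.T4Continuum.HistoryRealiseCellsRunApexT3bW Summit.QuantumFields.BalabanUV.T4Continuum.HistoryRealiseCellsRunHeadlineT3bP
open Summit.QuantumFields.BalabanUV.T4Continuum.HistoryRealiseCellsRunMultEndPDWT Summit.QuantumFields.BalabanUV.T4Continuum.HistoryRealiseCellsRunPinnedT3bPWT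
open Summit.QuantumFields.BalabanUV.T4Continuum.HistoryRealiseCellsRunApexT3bWT Summit.QuantumFields.BalabanUV.T4Continuum.HistoryRealiseCellsRunHeadlineT3bPW
namespace Summit.QuantumFields.BalabanUV.T4Continuum.HistoryRealiseCellsRunHeadlineT3bPWT

noncomputable section

section Under

variable {F : T4Family} {G : Type*} [GaugeGroup G] [MeasurableSpace G] [HaarData G] [RegularGaugeGroup G]

/-- **ROW NE7b AT THE APEX OVER THE REPAIRED END v3.1: `HybridNE7Under D (BetaPertHyp D.βfun)` FROM THE PREFIXED WITNESS
HYPOTHESIS, NO DEMAND ON PRINT's CONSTANTS.**  For data with measurable averaging maps, the datum's sign conventions and the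
repaired END's constants-only side conditions (any positive slack `θ`; inhabited — `exists_consts_countRoadT3bP`): if
`ForSmallCouplings D (g₀ ↦ ∀ os, a CountRoadWitnessT3bWT)` (H3 + representation + (B)-side data + NE7c + NE7 + rates —
DISPLAYED, none in print, none a theorem of the tree), then the apex input holds; thresholds `min γ₁ γ₂`, `min g₁ g₂` of the
pinned END v3.1 (`hybridNE7_of_realisedDomainsRunW_pinnedT3bPDT` — consuming `(B)`, `BetaPertHyp` BY NAME and paying the
multiplicity's level inside its `g₁`) and of the hypothesis.  Honest reading: the four T⁴ targets ⇐ (B) ∧ BetaPertHyp ∧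
[∀ small-coupling tuned run ∀ string, a count-road witness].  NE7b NOT proved. [folklore] -/
theorem hybridNE7Under_of_countRoadT3bPWT_fsc (D : FiniteEpsData F G) (hM : D.AvgMeasurable)
    (hsign : B16.SignConventions D.C)
    {C : T4PrintedShapeBanking.Consts} {O : PrintedO1s}
    {rr : ℕ} {β₀ : ℝ} (h : ThresholdOK C F.L rr β₀) (hμ : 0 < C.μ) (d n : ℕ)
    (hκ₁ : (d : ℝ) * Real.log F.L + 2 * Real.log 2 ≤ C.κ₁) (hE₀ : Real.log (2 + birthMass C) ≤ C.E₀)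
    (hA₀ : 1 ≤ C.A₀) (hβ₀ : 0 < β₀) (hLβ : (F.L : ℝ) * β₀ ≤ 1) (hn₁ : 13 ≤ C.n₁) (hn : 0 < n)
    {θ : ℝ} (hθ : 0 < θ) (hslack : C.a + θ ≤ O.γ₀ * O.A₁ ^ 2 / 2)
    (hE₂ : 0 < C.E₂) (hE₃ : 0 ≤ C.E₃) {sS : ℕ} (hsS : 1 ≤ sS)
    (hsmall : (((2 * cth 32 1 sS + 1) ^ d : ℕ) : ℝ) * (5 : ℝ) ^ d * ((max 1 (2 * 32 + 2) : ℕ) : ℝ) ≤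
      (F.L : ℝ) ^ (sS / 2) / 2)
    {θc : ℝ} (hθc0 : 0 ≤ θc) (hθc1 : θc < 1) (hθcs : 1 / 2 ≤ θc ^ sS)
    (hData : T4ContinuumYM4Torus.ForSmallCouplings D fun g₀ => ∀ os : List (ULoop F),
        ∃ (ι α π : Type) (_ : DecidableEq ι) (_ : DecidableEq α) (_ : DecidableEq π),
          Nonempty (CountRoadWitnessT3bWT D C O rr d n hn g₀ os ι α π)) :
    T4ApexHybrid.HybridNE7Under D (BetaPertHyp D.βfun) := by
  intro hB hβ
  obtain ⟨γ₁, hγ₁, H⟩ := hybridNE7_of_realisedDomainsRunW_pinnedT3bPDT D hB hβ hsign h hμ d n hκ₁ hE₀ hA₀ hβ₀ hLβ hn₁ hn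
    hθ hslack hE₂ hE₃ hsS hsmall hθc0 hθc1 hθcs
  obtain ⟨γ₂, hγ₂, H₂⟩ := hData
  refine ⟨min γ₁ γ₂, lt_min hγ₁ hγ₂, fun γ hγ hγle => ?_⟩
  obtain ⟨g₁, hg₁, Hg⟩ := H γ hγ (hγle.trans (min_le_left _ _))
  obtain ⟨g₂, hg₂, Hg₂⟩ := H₂ γ hγ (hγle.trans (min_le_right _ _))
  refine ⟨min g₁ g₂, lt_min hg₁ hg₂, fun g hg hgle g₀ ht os => ?_⟩
  obtain ⟨Em, -, HE⟩ := Hg g hg (hgle.trans (min_le_left _ _))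
  obtain ⟨ι, α, π, _, _, _, ⟨X⟩⟩ := Hg₂ g hg (hgle.trans (min_le_right _ _)) g₀ ht os
  have hm : ∀ K o, Measurable ((D.scheme g₀).obs K o) := fun K o => D.measurable_avgObs hM K o
  have h1 : ∀ K o U, |(D.scheme g₀).obs K o U| ≤ 1 := fun K o U => D.abs_avgObs_le_one K o U
  obtain ⟨K₁, K₂, hK₁, hH⟩ := HE g₀ ht X.l₀ X.vol X.K₀ X.T X.A X.A' X.shA X.shB X.dead X.dead' X.nup X.mup X.Nup
    X.Cc X.Rr X.CcRec X.RrRec X.ν X.u X.s₂ X.q₀ X.r X.s X.Wsh (fun K => T4GenFunBounds.prodObs (D.scheme g₀) K os) 1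
    (fun K => T4GenFunBounds.measurable_prodObs (D.scheme g₀) hm K os)
    (fun K U => T4GenFunBounds.abs_prodObs_le_one (D.scheme g₀) h1 K os U)
    (fun K t ht hK => (X.reprA K t ht hK).le) (fun K t ht hK => (X.reprB K t ht hK).le) X.c₀ X.n₁ X.c₀_pos X.floor
    X.floor' X.sites X.sites' X.Nup_nonneg X.nup_bd X.mup_bd X.R X.isRj X.one_le_R X.ped X.cellP X.liveC X.Zd X.realised
    X.step_le X.disjointJoins X.boxedBirths X.κ X.κ' X.cost_le X.cost_le' X.FcM X.RfM X.FcM' X.RfM' X.priceM X.priceM'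
    X.upM X.deadM_nonneg X.resumM X.FM_nonneg X.upM' X.deadM'_nonneg X.resumM' X.FM'_nonneg X.shell X.budget X.sum_r
    X.sum_u X.sum_s X.sum_s₂
  exact ⟨X.l₀, X.vol, K₁ + K₂, X.l₀_pos, X.vol_pos, stringHybridNE7_of_hybridNE7T3bWT D X hK₁ hH⟩

/-- **The every-`γ, g > 0` form** (a witness for EVERY positive-coupling tuned run and every string; thresholds `1, 1` on
the hypothesis' side): corollary of `hybridNE7Under_of_countRoadT3bPWT_fsc`.  CONDITIONAL; NE7b NOT proved. [folklore] -/
theorem hybridNE7Under_of_countRoadT3bPWT (D : FiniteEpsData F G) (hM : D.AvgMeasurable)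
    (hsign : B16.SignConventions D.C)
    {C : T4PrintedShapeBanking.Consts} {O : PrintedO1s}
    {rr : ℕ} {β₀ : ℝ} (h : ThresholdOK C F.L rr β₀) (hμ : 0 < C.μ) (d n : ℕ)
    (hκ₁ : (d : ℝ) * Real.log F.L + 2 * Real.log 2 ≤ C.κ₁) (hE₀ : Real.log (2 + birthMass C) ≤ C.E₀)
    (hA₀ : 1 ≤ C.A₀) (hβ₀ : 0 < β₀) (hLβ : (F.L : ℝ) * β₀ ≤ 1) (hn₁ : 13 ≤ C.n₁) (hn : 0 < n)
    {θ : ℝ} (hθ : 0 < θ) (hslack : C.a + θ ≤ O.γ₀ * O.A₁ ^ 2 / 2)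
    (hE₂ : 0 < C.E₂) (hE₃ : 0 ≤ C.E₃) {sS : ℕ} (hsS : 1 ≤ sS)
    (hsmall : (((2 * cth 32 1 sS + 1) ^ d : ℕ) : ℝ) * (5 : ℝ) ^ d * ((max 1 (2 * 32 + 2) : ℕ) : ℝ) ≤
      (F.L : ℝ) ^ (sS / 2) / 2)
    {θc : ℝ} (hθc0 : 0 ≤ θc) (hθc1 : θc < 1) (hθcs : 1 / 2 ≤ θc ^ sS)
    (hData : ∀ (γ g : ℝ) (g₀ : ℕ → ℝ), 0 < γ → 0 < g → D.Tuned γ g g₀ →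
      ∀ os : List (ULoop F), ∃ (ι α π : Type) (_ : DecidableEq ι) (_ : DecidableEq α) (_ : DecidableEq π),
        Nonempty (CountRoadWitnessT3bWT D C O rr d n hn g₀ os ι α π)) :
    T4ApexHybrid.HybridNE7Under D (BetaPertHyp D.βfun) :=
  hybridNE7Under_of_countRoadT3bPWT_fsc D hM hsign h hμ d n hκ₁ hE₀ hA₀ hβ₀ hLβ hn₁ hn hθ hslack hE₂ hE₃ hsS hsmall hθc0 hθc1 hθcs
    ⟨1, one_pos, fun γ hγ _ => ⟨1, one_pos, fun g hg _ g₀ ht => hData γ g g₀ hγ hg ht⟩⟩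

/-- **COROLLARY: EXISTENCE** of the continuum limit of every joint expectation of unit-scale averaged loop variables along
the full sequence of spacings, under the prefix (`D.ym4_torus_continuum_limit_exists`), GIVEN the prefixed witnesses — by
`T4ApexHybrid.limit_exists_of_hybridNE7Under` over the repaired END v3.1.  CONDITIONAL; NE7b NOT proved. [folklore] -/
theorem limit_exists_of_countRoadT3bPWT_fsc (D : FiniteEpsData F G) (hM : D.AvgMeasurable)
    (hsign : B16.SignConventions D.C)
    {C : T4PrintedShapeBanking.Consts} {O : PrintedO1s}
    {rr : ℕ} {β₀ : ℝ} (h : ThresholdOK C F.L rr β₀) (hμ : 0 < C.μ) (d n : ℕ)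
    (hκ₁ : (d : ℝ) * Real.log F.L + 2 * Real.log 2 ≤ C.κ₁) (hE₀ : Real.log (2 + birthMass C) ≤ C.E₀)
    (hA₀ : 1 ≤ C.A₀) (hβ₀ : 0 < β₀) (hLβ : (F.L : ℝ) * β₀ ≤ 1) (hn₁ : 13 ≤ C.n₁) (hn : 0 < n)
    {θ : ℝ} (hθ : 0 < θ) (hslack : C.a + θ ≤ O.γ₀ * O.A₁ ^ 2 / 2)
    (hE₂ : 0 < C.E₂) (hE₃ : 0 ≤ C.E₃) {sS : ℕ} (hsS : 1 ≤ sS)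
    (hsmall : (((2 * cth 32 1 sS + 1) ^ d : ℕ) : ℝ) * (5 : ℝ) ^ d * ((max 1 (2 * 32 + 2) : ℕ) : ℝ) ≤
      (F.L : ℝ) ^ (sS / 2) / 2)
    {θc : ℝ} (hθc0 : 0 ≤ θc) (hθc1 : θc < 1) (hθcs : 1 / 2 ≤ θc ^ sS)
    (hData : T4ContinuumYM4Torus.ForSmallCouplings D fun g₀ => ∀ os : List (ULoop F),
        ∃ (ι α π : Type) (_ : DecidableEq ι) (_ : DecidableEq α) (_ : DecidableEq π),
          Nonempty (CountRoadWitnessT3bWT D C O rr d n hn g₀ os ι α π)) :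
    D.ym4_torus_continuum_limit_exists :=
  T4ApexHybrid.limit_exists_of_hybridNE7Under D hM
    (hybridNE7Under_of_countRoadT3bPWT_fsc D hM hsign h hμ d n hκ₁ hE₀ hA₀ hβ₀ hLβ hn₁ hn hθ hslack hE₂ hE₃ hsS hsmall hθc0 hθc1 hθcs hData)

/-- **COROLLARY: UNIQUENESS** of the limit points (`D.ym4_torus_continuum_limit_unique`) under the same displayed data — by
`T4ApexHybrid.limit_unique_of_hybridNE7Under`.  CONDITIONAL; NE7b NOT proved. [folklore] -/
theorem limit_unique_of_countRoadT3bPWT_fsc (D : FiniteEpsData F G) (hM : D.AvgMeasurable)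
    (hsign : B16.SignConventions D.C)
    {C : T4PrintedShapeBanking.Consts} {O : PrintedO1s}
    {rr : ℕ} {β₀ : ℝ} (h : ThresholdOK C F.L rr β₀) (hμ : 0 < C.μ) (d n : ℕ)
    (hκ₁ : (d : ℝ) * Real.log F.L + 2 * Real.log 2 ≤ C.κ₁) (hE₀ : Real.log (2 + birthMass C) ≤ C.E₀)
    (hA₀ : 1 ≤ C.A₀) (hβ₀ : 0 < β₀) (hLβ : (F.L : ℝ) * β₀ ≤ 1) (hn₁ : 13 ≤ C.n₁) (hn : 0 < n)
    {θ : ℝ} (hθ : 0 < θ) (hslack : C.a + θ ≤ O.γ₀ * O.A₁ ^ 2 / 2)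
    (hE₂ : 0 < C.E₂) (hE₃ : 0 ≤ C.E₃) {sS : ℕ} (hsS : 1 ≤ sS)
    (hsmall : (((2 * cth 32 1 sS + 1) ^ d : ℕ) : ℝ) * (5 : ℝ) ^ d * ((max 1 (2 * 32 + 2) : ℕ) : ℝ) ≤
      (F.L : ℝ) ^ (sS / 2) / 2)
    {θc : ℝ} (hθc0 : 0 ≤ θc) (hθc1 : θc < 1) (hθcs : 1 / 2 ≤ θc ^ sS)
    (hData : T4ContinuumYM4Torus.ForSmallCouplings D fun g₀ => ∀ os : List (ULoop F),
        ∃ (ι α π : Type) (_ : DecidableEq ι) (_ : DecidableEq α) (_ : DecidableEq π),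
          Nonempty (CountRoadWitnessT3bWT D C O rr d n hn g₀ os ι α π)) :
    D.ym4_torus_continuum_limit_unique :=
  T4ApexHybrid.limit_unique_of_hybridNE7Under D hM
    (hybridNE7Under_of_countRoadT3bPWT_fsc D hM hsign h hμ d n hκ₁ hE₀ hA₀ hβ₀ hLβ hn₁ hn hθ hslack hE₂ hE₃ hsS hsmall hθc0 hθc1 hθcs hData)

end Under

section SU

variable {F : T4Family} {N : ℕ} [NeZero N] {ℰ : LoopAverage (Matrix.specialUnitaryGroup (Fin N) ℂ)}

/-- **THE FOUR T⁴ TARGETS FROM THE COUNT ROAD OVER THE REPAIRED END v3.1**, for (0.4)-block-averaged data on `SU(N)` with a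
measurable small-loop average: `hybridNE7Under_of_countRoadT3bPWT_fsc` ∘ `T4ApexHybrid.targets_of_hybridNE7Under`.  CONDITIONAL
on (B), `BetaPertHyp` (inside the targets' own prefix) and the displayed prefixed witnesses; NE7b NOT proved. [folklore] -/
theorem targets_of_countRoadT3bPWT_fsc (D : FiniteEpsData F (Matrix.specialUnitaryGroup (Fin N) ℂ))
    (hBA : D.IsBlockAveraged ℰ) (hE : ℰ.MeasurableE) (hsign : B16.SignConventions D.C)
    {C : T4PrintedShapeBanking.Consts} {O : PrintedO1s}
    {rr : ℕ} {β₀ : ℝ} (h : ThresholdOK C F.L rr β₀) (hμ : 0 < C.μ) (d n : ℕ)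
    (hκ₁ : (d : ℝ) * Real.log F.L + 2 * Real.log 2 ≤ C.κ₁) (hE₀ : Real.log (2 + birthMass C) ≤ C.E₀)
    (hA₀ : 1 ≤ C.A₀) (hβ₀ : 0 < β₀) (hLβ : (F.L : ℝ) * β₀ ≤ 1) (hn₁ : 13 ≤ C.n₁) (hn : 0 < n)
    {θ : ℝ} (hθ : 0 < θ) (hslack : C.a + θ ≤ O.γ₀ * O.A₁ ^ 2 / 2)
    (hE₂ : 0 < C.E₂) (hE₃ : 0 ≤ C.E₃) {sS : ℕ} (hsS : 1 ≤ sS)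
    (hsmall : (((2 * cth 32 1 sS + 1) ^ d : ℕ) : ℝ) * (5 : ℝ) ^ d * ((max 1 (2 * 32 + 2) : ℕ) : ℝ) ≤
      (F.L : ℝ) ^ (sS / 2) / 2)
    {θc : ℝ} (hθc0 : 0 ≤ θc) (hθc1 : θc < 1) (hθcs : 1 / 2 ≤ θc ^ sS)
    (hData : T4ContinuumYM4Torus.ForSmallCouplings D fun g₀ => ∀ os : List (ULoop F),
        ∃ (ι α π : Type) (_ : DecidableEq ι) (_ : DecidableEq α) (_ : DecidableEq π),
          Nonempty (CountRoadWitnessT3bWT D C O rr d n hn g₀ os ι α π)) :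
    D.ym4_torus_continuum_limit_exists ∧ D.ym4_torus_continuum_limit_unique ∧
      D.limit_reflectionPositive ∧ D.limit_torusCovariant :=
  T4ApexHybrid.targets_of_hybridNE7Under hBA hE
    (hybridNE7Under_of_countRoadT3bPWT_fsc D (hBA.avgMeasurable hE) hsign h hμ d n hκ₁ hE₀ hA₀ hβ₀ hLβ hn₁ hn hθ hslack hE₂ hE₃ hsS hsmall hθc0 hθc1 hθcs hData)

/-- **THE HEADLINE PREDICATE FROM THE COUNT ROAD OVER THE REPAIRED END v3.1**: `T4ContinuumYM4Torus.ContinuumYM4Torus D` for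
(0.4)-block-averaged data on `SU(N)` with a measurable small-loop average, GIVEN the two pins
`(B) = B16.EndStatementBPrinted D.C` and `BetaPertHyp D.βfun` BY NAME, the datum's sign conventions, the repaired END's
INHABITED constants-only side conditions (any positive slack; `exists_consts_countRoadT3bP`), and a `CountRoadWitnessT3bWT` for
all small-coupling tuned runs and every loop string (`targets_of_countRoadT3bPWT_fsc` ∘
`T4ContinuumYM4Torus.continuumYM4Torus_of_targets`).  Honest reading in the module docstring: the located new estimates are
INSIDE the witness; nothing of them is discharged; the multiplicity is a theorem and its price sits in the coupling
threshold; NE7b NOT proved; count 0∕9. [folklore] -/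
theorem continuumYM4Torus_of_countRoadT3bPWT_fsc (D : FiniteEpsData F (Matrix.specialUnitaryGroup (Fin N) ℂ))
    (hBA : D.IsBlockAveraged ℰ) (hE : ℰ.MeasurableE)
    (hB : B16.EndStatementBPrinted D.C) (hβ : BetaPertHyp D.βfun) (hsign : B16.SignConventions D.C)
    {C : T4PrintedShapeBanking.Consts} {O : PrintedO1s}
    {rr : ℕ} {β₀ : ℝ} (h : ThresholdOK C F.L rr β₀) (hμ : 0 < C.μ) (d n : ℕ)
    (hκ₁ : (d : ℝ) * Real.log F.L + 2 * Real.log 2 ≤ C.κ₁) (hE₀ : Real.log (2 + birthMass C) ≤ C.E₀)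
    (hA₀ : 1 ≤ C.A₀) (hβ₀ : 0 < β₀) (hLβ : (F.L : ℝ) * β₀ ≤ 1) (hn₁ : 13 ≤ C.n₁) (hn : 0 < n)
    {θ : ℝ} (hθ : 0 < θ) (hslack : C.a + θ ≤ O.γ₀ * O.A₁ ^ 2 / 2)
    (hE₂ : 0 < C.E₂) (hE₃ : 0 ≤ C.E₃) {sS : ℕ} (hsS : 1 ≤ sS)
    (hsmall : (((2 * cth 32 1 sS + 1) ^ d : ℕ) : ℝ) * (5 : ℝ) ^ d * ((max 1 (2 * 32 + 2) : ℕ) : ℝ) ≤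
      (F.L : ℝ) ^ (sS / 2) / 2)
    {θc : ℝ} (hθc0 : 0 ≤ θc) (hθc1 : θc < 1) (hθcs : 1 / 2 ≤ θc ^ sS)
    (hData : T4ContinuumYM4Torus.ForSmallCouplings D fun g₀ => ∀ os : List (ULoop F),
        ∃ (ι α π : Type) (_ : DecidableEq ι) (_ : DecidableEq α) (_ : DecidableEq π),
          Nonempty (CountRoadWitnessT3bWT D C O rr d n hn g₀ os ι α π)) :
    T4ContinuumYM4Torus.ContinuumYM4Torus D :=
  T4ContinuumYM4Torus.continuumYM4Torus_of_targets hB hβ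
    (targets_of_countRoadT3bPWT_fsc D hBA hE hsign h hμ d n hκ₁ hE₀ hA₀ hβ₀ hLβ hn₁ hn hθ hslack hE₂ hE₃ hsS hsmall hθc0 hθc1 hθcs hData)

/-! ## The total-form W-headline implies the W-headline and the headline of record, on their own witnesses -/

/- **THE TOTAL-FORM W-HEADLINE IS AT LEAST AS STRONG AS THE W-HEADLINE E8 (round trip, by name; kernel-checked
`example`).**  From E8's OWN prefixed hypothesis — a `CountRoadWitnessT3bW` (STEPWISE cost fields) for every
small-coupling tuned run and loop string — the total-form chain gives E8's conclusion `ContinuumYM4Torus D`: map each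
witness through `CountRoadWitnessT3bW.toT` (file E6T; `ForSmallCouplings.mono`) and apply
`continuumYM4Torus_of_countRoadT3bPWT_fsc`.  Binders and conclusion are LITERALLY those of
`HistoryRealiseCellsRunHeadlineT3bPW.continuumYM4Torus_of_countRoadT3bPW_fsc` (p255842; hence an `example`, not a second
declaration of that statement); nothing of print asserted; NE7b NOT proved. [folklore] -/
example (D : FiniteEpsData F (Matrix.specialUnitaryGroup (Fin N) ℂ))
    (hBA : D.IsBlockAveraged ℰ) (hE : ℰ.MeasurableE)
    (hB : B16.EndStatementBPrinted D.C) (hβ : BetaPertHyp D.βfun) (hsign : B16.SignConventions D.C)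
    {C : T4PrintedShapeBanking.Consts} {O : PrintedO1s}
    {rr : ℕ} {β₀ : ℝ} (h : ThresholdOK C F.L rr β₀) (hμ : 0 < C.μ) (d n : ℕ)
    (hκ₁ : (d : ℝ) * Real.log F.L + 2 * Real.log 2 ≤ C.κ₁) (hE₀ : Real.log (2 + birthMass C) ≤ C.E₀)
    (hA₀ : 1 ≤ C.A₀) (hβ₀ : 0 < β₀) (hLβ : (F.L : ℝ) * β₀ ≤ 1) (hn₁ : 13 ≤ C.n₁) (hn : 0 < n)
    {θ : ℝ} (hθ : 0 < θ) (hslack : C.a + θ ≤ O.γ₀ * O.A₁ ^ 2 / 2)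
    (hE₂ : 0 < C.E₂) (hE₃ : 0 ≤ C.E₃) {sS : ℕ} (hsS : 1 ≤ sS)
    (hsmall : (((2 * cth 32 1 sS + 1) ^ d : ℕ) : ℝ) * (5 : ℝ) ^ d * ((max 1 (2 * 32 + 2) : ℕ) : ℝ) ≤
      (F.L : ℝ) ^ (sS / 2) / 2)
    {θc : ℝ} (hθc0 : 0 ≤ θc) (hθc1 : θc < 1) (hθcs : 1 / 2 ≤ θc ^ sS)
    (hData : T4ContinuumYM4Torus.ForSmallCouplings D fun g₀ => ∀ os : List (ULoop F),
        ∃ (ι α π : Type) (_ : DecidableEq ι) (_ : DecidableEq α) (_ : DecidableEq π),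
          Nonempty (CountRoadWitnessT3bW D C O rr d n hn g₀ os ι α π)) :
    T4ContinuumYM4Torus.ContinuumYM4Torus D :=
  continuumYM4Torus_of_countRoadT3bPWT_fsc D hBA hE hB hβ hsign h hμ d n hκ₁ hE₀ hA₀ hβ₀ hLβ hn₁ hn hθ hslack hE₂ hE₃ hsS
    hsmall hθc0 hθc1 hθcs
    (hData.mono fun g₀ hg os => by
      obtain ⟨ι, α, π, i₁, i₂, i₃, ⟨X⟩⟩ := hg os
      exact ⟨ι, α, π, i₁, i₂, i₃, ⟨CountRoadWitnessT3bW.toT X⟩⟩)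

/- **… AND AT LEAST AS STRONG AS THE HEADLINE OF RECORD p224237 (round trip, by name; kernel-checked `example`).**  From
p224237's OWN prefixed hypothesis — a landed-carrier `CountRoadWitnessT3b` for every small-coupling tuned run and loop
string — through `CountRoadWitnessT3b.toWT` (file E6T: E6's carrier bridge `toW`, then `toT`).  Binders and conclusion are
LITERALLY those of `HistoryRealiseCellsRunHeadlineT3bP.continuumYM4Torus_of_countRoadT3bP_fsc` (p224237). [folklore] -/
example (D : FiniteEpsData F (Matrix.specialUnitaryGroup (Fin N) ℂ))
    (hBA : D.IsBlockAveraged ℰ) (hE : ℰ.MeasurableE)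
    (hB : B16.EndStatementBPrinted D.C) (hβ : BetaPertHyp D.βfun) (hsign : B16.SignConventions D.C)
    {C : T4PrintedShapeBanking.Consts} {O : PrintedO1s}
    {rr : ℕ} {β₀ : ℝ} (h : ThresholdOK C F.L rr β₀) (hμ : 0 < C.μ) (d n : ℕ)
    (hκ₁ : (d : ℝ) * Real.log F.L + 2 * Real.log 2 ≤ C.κ₁) (hE₀ : Real.log (2 + birthMass C) ≤ C.E₀)
    (hA₀ : 1 ≤ C.A₀) (hβ₀ : 0 < β₀) (hLβ : (F.L : ℝ) * β₀ ≤ 1) (hn₁ : 13 ≤ C.n₁) (hn : 0 < n)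
    {θ : ℝ} (hθ : 0 < θ) (hslack : C.a + θ ≤ O.γ₀ * O.A₁ ^ 2 / 2)
    (hE₂ : 0 < C.E₂) (hE₃ : 0 ≤ C.E₃) {sS : ℕ} (hsS : 1 ≤ sS)
    (hsmall : (((2 * cth 32 1 sS + 1) ^ d : ℕ) : ℝ) * (5 : ℝ) ^ d * ((max 1 (2 * 32 + 2) : ℕ) : ℝ) ≤
      (F.L : ℝ) ^ (sS / 2) / 2)
    {θc : ℝ} (hθc0 : 0 ≤ θc) (hθc1 : θc < 1) (hθcs : 1 / 2 ≤ θc ^ sS)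
    (hData : T4ContinuumYM4Torus.ForSmallCouplings D fun g₀ => ∀ os : List (ULoop F),
        ∃ (ι α π : Type) (_ : DecidableEq ι) (_ : DecidableEq α) (_ : DecidableEq π),
          Nonempty (CountRoadWitnessT3b D C O rr d n hn g₀ os ι α π)) :
    T4ContinuumYM4Torus.ContinuumYM4Torus D :=
  continuumYM4Torus_of_countRoadT3bPWT_fsc D hBA hE hB hβ hsign h hμ d n hκ₁ hE₀ hA₀ hβ₀ hLβ hn₁ hn hθ hslack hE₂ hE₃ hsS
    hsmall hθc0 hθc1 hθcs
    (hData.mono fun g₀ hg os => by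
      obtain ⟨ι, α, π, i₁, i₂, i₃, ⟨X⟩⟩ := hg os
      exact ⟨ι, α, π, i₁, i₂, i₃, ⟨CountRoadWitnessT3b.toWT X⟩⟩)

end SU

end

end Summit.QuantumFields.BalabanUV.T4Continuum.HistoryRealiseCellsRunHeadlineT3bPWT
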